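import Mathlib.Data.Int.LeastGreatest
import Mathlib.LinearAlgebra.Eigenspace.Minpoly
import Mathlib.LinearAlgebra.FiniteDimensional.Lemmas
import Mathlib.NumberTheory.NumberField.CanonicalEmbedding.Basic
import Literature.AlgebraicGeometry.Motives.WeilTypeCM
import HarnessLib

/-!
# Discharged facts: `σ`-eigenspaces, multiplicities and CM types of a number-field action

`Literature.AlgebraicGeometry.Motives.WeilTypeCM` records named facts (`… : Prop`) about an
action `A : EndAction H E` of a number field `E` on a `ℚ`-Hodge structure `H` on `V`. This file
proves four of them — `iSupIndep_eigenPiece_holds`, `iSup_eigenPiece_holds`,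
`multiplicity_add_multiplicity_conjugate_holds` and `mem_cmType_iff_conjugate_notMem_holds` (all in
`Literature.AlgebraicGeometry.Motives.HodgeStructure.EndAction`) — so users holding `(h : X)` can discharge the hypothesis with
`X_holds`. It is definition-free (proofs only).

## 1. The `σ`-eigenspace decomposition (`iSupIndep_eigenPiece_holds`, `iSup_eigenPiece_holds`)

`Literature.AlgebraicGeometry.Motives.WeilTypeCM` records as named facts
(`Literature.HodgeStructure.EndAction.iSupIndep_eigenPiece : Prop` and
`Literature.HodgeStructure.EndAction.iSup_eigenPiece : Prop`) that for an action `A : EndAction H E` of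
a number field `E` on a `ℚ`-Hodge structure `H` on `V`, the eigen-subspaces
`V^{p,q}_σ = A.eigenPiece σ p q` (`σ : E →+* ℂ`) of a Hodge piece `V^{p,q} ⊆ V_ℂ` form an
independent family (`iSupIndep`) and span `V^{p,q}` (`⨆ σ, V^{p,q}_σ = V^{p,q}`). Together these
are the decomposition `V_ℂ = ⊕_{σ ∈ Hom(E,ℂ)} V_σ`, "`e ∈ E` acts on `V_σ` as `σ e`",
corresponding to `E ⊗_ℚ ℂ ≅ ∏_{σ ∈ Hom(E,ℂ)} ℂ`, compatible with the Hodge decomposition since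
`E` respects it (Deligne, *Hodge cycles on abelian varieties*, LNM 900, §4, p. 30, the display
preceding Prop. 4.4, there for `V = H¹_B(A)`:
`H¹_B(A) ⊗ ℂ = ⊕_{σ ∈ S} H¹_{B,σ}`, `H¹_{B,σ} = H^{1,0}_{B,σ} ⊕ H^{0,1}_{B,σ}`). This file proves
both (`Literature.AlgebraicGeometry.Motives.HodgeStructure.EndAction.iSupIndep_eigenPiece_holds`,
`Literature.AlgebraicGeometry.Motives.HodgeStructure.EndAction.iSup_eigenPiece_holds`), so users holding
`(h : iSupIndep_eigenPiece)` / `(h : iSup_eigenPiece)` can discharge the hypothesis.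

### Proofs

Pure linear algebra (the source treats it as evident); no finite-dimensionality of `V` is used.

Independence:
* choose a primitive element `α` of `E/ℚ` (`Field.exists_primitive_element`; `E` is a finite
  separable extension of `ℚ`);
* distinct embeddings `σ : E →+* ℂ` have distinct `σ α`
  (`complexEmbedding_apply_injective_of_adjoin_eq_top`, from Mathlib's
  `Field.primitive_element_iff_algHom_eq_of_eval'` transported along `RingHom.toRatAlgHom`);
* `V^{p,q}_σ ≤ eigenspace ((ι α)_ℂ) (σ α)` by definition of `eigenPiece`, and eigenspaces of a
  single endomorphism at pairwise distinct eigenvalues are independent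
  (`Module.End.eigenspaces_iSupIndep`, `iSupIndep.comp`, `iSupIndep.mono`).

Spanning:
* `W = V^{p,q}` is stable under every `(ι e)_ℂ` (`baseChange_apply_mem_piece`: `(ι e)_ℂ`
  preserves `F^p` and commutes with complex conjugation);
* for a primitive element `α` (`Field.powerBasisOfFiniteOfSeparable`) the minimal polynomial
  of `α` kills `T = (ι α)_ℂ` and splits over `ℂ` with simple roots, which are exactly the
  `σ α`, `σ ∈ Hom(E, ℂ)` (`NumberField.Embeddings.range_eval_eq_rootSet_minpoly`);
* kernel decomposition on the `T`-stable `W` (`mem_iSup_inf_eigenspace_of_aeval_prod_eq_zero`,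
  Bézout): `W ≤ Σ_σ W ∩ ker (T - σ α)`;
* on `ker (T - σ α)` every `e = g(α) ∈ E` acts by `g(σ α) = σ e`
  (`baseChange_apply_of_mem_eigenspace_gen`), so `W ∩ ker (T - σ α) ≤ V^{p,q}_σ`.

## 2. Multiplicities and CM types (`multiplicity_add_multiplicity_conjugate_holds`,
`mem_cmType_iff_conjugate_notMem_holds`)

In weight `1`, with `n_σ = dim_ℂ V^{1,0}_σ` (`EndAction.multiplicity`):
* `multiplicity_add_multiplicity_conjugate`: for `H` effective and `V` finite-dimensional,
  `(n_σ + n_σ̄) · [E:ℚ] = dim_ℚ V`;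
* `mem_cmType_iff_conjugate_notMem`: for a CM action (`IsCM A`: `H` effective, `E` a CM field,
  `dim_E V = 1`), `Φ = cmType A = {σ | n_σ = 1}` satisfies `σ ∈ Φ ↔ σ̄ ∉ Φ`, i.e. it is a CM
  type (`IsCM.exists_cmType_eq`).

This is the linear algebra of Deligne, LNM 900, Example 3.7 (pp. 25–26 of Milne's re-typeset
edition): for `H₁(A, ℚ) ≃ E`, `H₁(A) ⊗ ℂ ≃ E ⊗_ℚ ℂ → ℂ^S = ℂ^Σ ⊕ ℂ^{ιΣ}`, `S = Hom(E, ℂ) = Σ ⊔ ιΣ`,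
with `ℂ^Σ` the `(-1,0)`-component and `ℂ^{ιΣ}` the `(0,-1)`-component; and of §5, p. 37, where
the abelian varieties with complex multiplication by `E` ("so `H₁(A)` has dimension `1` over
`E`", cf. Prop. 5.1, p. 36) are indexed by the CM types for `E`, the `Φ ⊂ S` with `S = Φ ⊔ ιΦ`.

### Proofs

Write `V_{ℂ,σ} = {x ∈ V_ℂ | ∀ e, (ι e)_ℂ x = σ(e) x}` for the full simultaneous eigenspace
(spelled out as `⨅ e, eigenspace ((ι e)_ℂ) (σ e)` in the statements, this file being
definition-free; `V^{p,q}_σ = V^{p,q} ∩ V_{ℂ,σ}` by definition of `eigenPiece`).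
* `finrank_iInf_eigenspace_mul_finrank`: `dim_ℂ V_{ℂ,σ} · [E:ℚ] = dim_ℚ V` — an `E`-basis of
  `V` (`Module.finBasis`) and `E ⊗_ℚ ℂ ≃ ℂ^S` (`NumberField.canonicalEmbedding.latticeBasis`,
  `NumberField.Embeddings.card`) give `V_ℂ ≃ (ℂ^S)^r` with `E` acting on the `σ`-th
  coordinates through `σ`, so `V_{ℂ,σ} ≃ ℂ^r`;
* `IsEffective.F_eq_top`: `F^0 = V_ℂ` for an effective Hodge structure, whence `V^{1,0} = F^1`
  in weight `1` (`piece_one_zero_eq_F`);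
* `V_ℂ = F^1 ⊕ conj F^1` (opposedness) with both summands `E`-stable splits `V_{ℂ,σ}`
  accordingly (`iInf_eigenspace_eq_inf_sup_inf`), and `conj (V_{ℂ,σ} ∩ conj F^1) = V^{1,0}_{σ̄}`
  (`complexConj_iInf_eigenspace`, `finrank_complexConj`), giving `n_σ + n_σ̄ = dim_ℂ V_{ℂ,σ}`;
* for a CM action `dim_ℚ V = [E:ℚ]`, so `n_σ + n_σ̄ = 1`
  (`IsCM.multiplicity_add_multiplicity_conjugate_eq_one`), and `σ ∈ Φ ↔ σ̄ ∉ Φ` follows since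
  `n_σ, n_σ̄ ∈ ℕ`.

## Mathlib

`Field.exists_primitive_element`, `Field.powerBasisOfFiniteOfSeparable`,
`Module.End.eigenspaces_iSupIndep`, `NumberField.Embeddings.range_eval_eq_rootSet_minpoly`
(part 1); `NumberField.canonicalEmbedding` and its `latticeBasis` (a `ℂ`-basis of `ℂ^{Hom(E,ℂ)}`
in the image of `E`, from the nonvanishing of the discriminant), `NumberField.Embeddings.card`,
`NumberField.ComplexEmbedding.conjugate`, `Module.finBasis`, `rank_eq_of_equiv_equiv` (part 2).

## References

* P. Deligne (notes by J. S. Milne), *Hodge cycles on abelian varieties*, in: Hodge cycles,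
  motives, and Shimura varieties, Lecture Notes in Math. 900, Springer (1982), 9–100,
  doi:10.1007/978-3-540-38955-2_3; §4 p. 30 (part 1), Example 3.7 pp. 25–26 and §5 pp. 36–37
  (part 2), page numbers of Milne's re-typeset edition. [DeligneLNM900]
* P. Deligne, *Théorie de Hodge II*, Publ. Math. IHÉS 40 (1971), 5–57, 1.2.5 and 2.2
  (opposed filtrations, effectivity).
* B. Moonen, Yu. Zarhin, *Hodge classes and Tate classes on simple abelian fourfolds*, Duke
  Math. J. 77 (1995), 553–581, §2.2 (the function `σ ↦ n_σ`). [MoonenZarhin1995]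
-/

open scoped IntermediateField TensorProduct
open Polynomial

noncomputable section

namespace Literature.AlgebraicGeometry.Motives

universe u

/-! ### Generic linear algebra: kernel decomposition on a stable submodule -/

section Aux

variable {K : Type*} [Field K] {M : Type*} [AddCommGroup M] [Module K M]

/-- Kernel decomposition on a stable submodule: if `W` is `T`-stable and `x ∈ W` is killed by
`∏_{a ∈ s} (T - a)` for a finite set `s` of (distinct) scalars, then `x` lies in the sum over
`a ∈ s` of the `W ∩ ker (T - a)` (Bézout: `X - a` and `∏_{b ≠ a} (X - b)` are coprime, and the
two Bézout components of `x` are polynomials in `T` applied to `x`, so stay in `W`,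
`Polynomial.aeval_apply_smul_mem_of_le_comap`). [folklore] -/
theorem mem_iSup_inf_eigenspace_of_aeval_prod_eq_zero {T : Module.End K M} {W : Submodule K M}
    (hW : ∀ x ∈ W, T x ∈ W) (s : Finset K) :
    ∀ x ∈ W, aeval T (∏ a ∈ s, (X - C a)) x = 0 → x ∈ ⨆ a ∈ s, W ⊓ T.eigenspace a := by
  classical
  induction s using Finset.induction_on with
  | empty =>
    intro x _ hx
    rw [Finset.prod_empty, map_one, Module.End.one_apply] at hx
    simp [hx]
  | insert a s ha ih =>
    intro x hxW hx
    rw [Finset.prod_insert ha] at hx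
    have hcop : IsCoprime (X - C a) (∏ b ∈ s, (X - C b)) :=
      IsCoprime.prod_right fun b hb =>
        isCoprime_X_sub_C_of_isUnit_sub
          (sub_ne_zero_of_ne (ne_of_mem_of_not_mem hb ha).symm).isUnit
    obtain ⟨u, v, huv⟩ := hcop
    set Q := ∏ b ∈ s, (X - C b) with hQ
    have hsplit : x = aeval T (v * Q) x + aeval T (u * (X - C a)) x := by
      rw [← LinearMap.add_apply, ← map_add, add_comm, huv, map_one, Module.End.one_apply]
    rw [Finset.iSup_insert, hsplit]
    refine Submodule.add_mem _ (Submodule.mem_sup_left ?_) (Submodule.mem_sup_right ?_)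
    · refine ⟨aeval_apply_smul_mem_of_le_comap hxW _ T hW, ?_⟩
      have h0 : aeval T (X - C a) (aeval T (v * Q) x) = 0 := by
        rw [← Module.End.mul_apply, ← map_mul, show (X - C a) * (v * Q) = v * ((X - C a) * Q) by
          ring, map_mul, Module.End.mul_apply, hx, map_zero]
      rw [SetLike.mem_coe, Module.End.mem_eigenspace_iff, ← sub_eq_zero]
      simpa [Module.algebraMap_end_apply] using h0
    · refine ih _ (aeval_apply_smul_mem_of_le_comap hxW _ T hW) ?_
      rw [← Module.End.mul_apply, ← map_mul, show Q * (u * (X - C a)) = u * ((X - C a) * Q) by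
        ring, map_mul, Module.End.mul_apply, hx, map_zero]

end Aux

variable {V : Type u} [AddCommGroup V] [Module ℚ V] {n : ℤ}

namespace HodgeStructure.EndAction

variable {E : Type*} [Field E] [NumberField E] {H : HodgeStructure V n}

/-! ### Independence of the `σ`-eigenspaces -/

/-- Distinct complex embeddings `σ : E →+* ℂ` of a number field take distinct values at a
primitive element `α` (`ℚ⟮α⟯ = E`): a ring homomorphism out of `E = ℚ(α)` is determined by the
image of `α` (Mathlib's `Field.primitive_element_iff_algHom_eq_of_eval'`, transported from
`ℚ`-algebra to ring homomorphisms). [folklore] -/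
theorem complexEmbedding_apply_injective_of_adjoin_eq_top {α : E} (hα : ℚ⟮α⟯ = ⊤) :
    Function.Injective fun σ : E →+* ℂ => σ α := by
  have hA : ∀ x : E, ((minpoly ℚ x).map (algebraMap ℚ ℂ)).Splits := fun x =>
    IsAlgClosed.splits _
  have h := (Field.primitive_element_iff_algHom_eq_of_eval' ℚ ℂ hA α).mp hα
  intro σ τ hστ
  have : σ.toRatAlgHom = τ.toRatAlgHom := h (by simpa using hστ)
  simpa using congrArg AlgHom.toRingHom this

/-- **Discharge of `iSupIndep_eigenPiece`.** The `σ`-eigenspaces `V^{p,q}_σ`, `σ ∈ Hom(E, ℂ)`, of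
the Hodge piece `V^{p,q}` form an independent family — the independence half of the
decomposition `V_ℂ = ⊕_{σ ∈ Hom(E,ℂ)} V_σ`, "`e ∈ E` acts on `V_σ` as `σ e`", corresponding to
`E ⊗_ℚ ℂ ≅ ∏_{σ} ℂ` (Deligne, *Hodge cycles on abelian varieties*, LNM 900, §4, p. 30, the
display preceding Prop. 4.4). Proof: choose a primitive element `α` of `E/ℚ`; then
`V^{p,q}_σ ≤ ker((ι α)_ℂ - σ α)`, the eigenvalues `σ α` are pairwise distinct
(`complexEmbedding_apply_injective_of_adjoin_eq_top`), and eigenspaces of one endomorphism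
for distinct eigenvalues are independent (`Module.End.eigenspaces_iSupIndep`). [cite: DeligneLNM900, §4 p.30 (decomposition H¹_B ⊗ ℂ = ⊕_σ H¹_{B,σ})] -/
theorem iSupIndep_eigenPiece_holds : iSupIndep_eigenPiece (H := H) (E := E) := by
  intro A p q
  obtain ⟨α, hα⟩ := Field.exists_primitive_element ℚ E
  have hind := (Module.End.eigenspaces_iSupIndep ((A.ι α).baseChange ℂ)).comp
    (complexEmbedding_apply_injective_of_adjoin_eq_top hα)
  exact hind.mono fun σ => inf_le_right.trans (iInf_le _ α)

/-! ### Spanning by the `σ`-eigenspaces -/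

/-- The Hodge pieces `V^{p,q}` are stable under the (complexified) `E`-action: `(ι e)_ℂ`
preserves `F^p` (`EndAction.map_F_le`) and commutes with complex conjugation
(`conj_baseChange`), hence also preserves `conj F^q`. [folklore] -/
theorem baseChange_apply_mem_piece (A : EndAction H E) (e : E) {p q : ℤ} {x : ℂ ⊗[ℚ] V}
    (hx : x ∈ H.piece p q) : (A.ι e).baseChange ℂ x ∈ H.piece p q := by
  by_cases hpq : p + q = n
  · rw [mem_piece_iff H hpq] at hx ⊢
    refine ⟨A.map_F_le e p (Submodule.mem_map_of_mem hx.1), ?_⟩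
    rw [conj_baseChange]
    exact A.map_F_le e q (Submodule.mem_map_of_mem hx.2)
  · rw [piece_eq_bot_of_add_ne H hpq] at hx ⊢
    rw [(Submodule.mem_bot ℂ).1 hx, map_zero]
    exact Submodule.zero_mem _

/-- On an eigenvector of `(ι α)_ℂ` with eigenvalue `σ α`, `α` a generator of `E/ℚ`
(`pb : PowerBasis ℚ E`, `α = pb.gen`), every `(ι e)_ℂ`, `e ∈ E`, acts by the scalar `σ e`:
write `e = g(α)` with `g ∈ ℚ[X]`; then `(ι e)_ℂ = g((ι α)_ℂ)` acts by `g(σ α) = σ (g α) = σ e`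
(`Module.End.aeval_apply_of_mem_apply_eq_smul`). [folklore] -/
theorem baseChange_apply_of_mem_eigenspace_gen (A : EndAction H E) (pb : PowerBasis ℚ E)
    (σ : E →+* ℂ) {x : ℂ ⊗[ℚ] V}
    (hx : x ∈ Module.End.eigenspace ((A.ι pb.gen).baseChange ℂ) (σ pb.gen)) (e : E) :
    (A.ι e).baseChange ℂ x = σ e • x := by
  obtain ⟨g, hg⟩ := pb.exists_eq_aeval' e
  let Φ : E →ₐ[ℚ] Module.End ℂ (ℂ ⊗[ℚ] V) := (Module.End.baseChangeHom ℚ ℂ V).comp A.ι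
  have hΦ : ∀ e' : E, (A.ι e').baseChange ℂ = Φ e' := fun _ => rfl
  have h1 : (A.ι e).baseChange ℂ = aeval (Φ pb.gen) (g.map (algebraMap ℚ ℂ)) := by
    rw [aeval_map_algebraMap, aeval_algHom_apply, ← hg]
    exact hΦ e
  have h2 : σ e = (g.map (algebraMap ℚ ℂ)).eval (σ pb.gen) := by
    rw [eval_map_algebraMap, hg, ← RingHom.toRatAlgHom_apply σ, ← aeval_algHom_apply,
      RingHom.toRatAlgHom_apply]
  rw [h1, h2]
  exact Module.End.aeval_apply_of_mem_apply_eq_smul (Module.End.mem_eigenspace_iff.1 hx)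

/-- **Discharge of `iSup_eigenPiece`.** The `σ`-eigenspaces `V^{p,q}_σ`, `σ ∈ Hom(E, ℂ)`, span
the Hodge piece: `⨆ σ, V^{p,q}_σ = V^{p,q}` — the spanning half of the decomposition
`V_ℂ = ⊕_{σ ∈ Hom(E,ℂ)} V_σ`, "`e ∈ E` acts on `V_σ` as `σ e`", corresponding to
`E ⊗_ℚ ℂ ≅ ∏_{σ} ℂ`, compatible with the Hodge decomposition as `E` respects it (Deligne,
*Hodge cycles on abelian varieties*, LNM 900, §4, p. 30 of Milne's notes, the display preceding
Prop. 4.4: `H¹_B(A) ⊗ ℂ = ⊕_{σ ∈ S} H¹_{B,σ}`, `H¹_{B,σ} = H^{1,0}_{B,σ} ⊕ H^{0,1}_{B,σ}`).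
Proof: `≤` is `eigenPiece_le_piece`. For `≥`, take a primitive element `α` of `E/ℚ`
(`Field.powerBasisOfFiniteOfSeparable`); its minimal polynomial kills `T = (ι α)_ℂ`
(`minpoly.aeval`) and splits over `ℂ` with simple roots (separability), which are the `σ α`
(`NumberField.Embeddings.range_eval_eq_rootSet_minpoly`); the `E`-stable piece `W = V^{p,q}`
(`baseChange_apply_mem_piece`) therefore lies in `Σ_σ W ∩ ker (T - σ α)`
(`mem_iSup_inf_eigenspace_of_aeval_prod_eq_zero`), and on `ker (T - σ α)` every `e ∈ E` acts
by `σ e` (`baseChange_apply_of_mem_eigenspace_gen`), i.e. `W ∩ ker (T - σ α) ≤ V^{p,q}_σ`.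
No finite-dimensionality of `V` is needed. [cite: DeligneLNM900, §4 p.30 (decomposition H¹_B ⊗ ℂ = ⊕_σ H¹_{B,σ}, display preceding Prop. 4.4)] -/
theorem iSup_eigenPiece_holds : iSup_eigenPiece (H := H) (E := E) := by
  intro A p q
  refine le_antisymm (iSup_le fun σ => A.eigenPiece_le_piece σ p q) fun x hx => ?_
  classical
  set W := H.piece p q
  let pb := Field.powerBasisOfFiniteOfSeparable ℚ E
  set T : Module.End ℂ (ℂ ⊗[ℚ] V) := (A.ι pb.gen).baseChange ℂ with hT
  have hWT : ∀ y ∈ W, T y ∈ W := fun y hy => A.baseChange_apply_mem_piece pb.gen hy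
  -- the minimal polynomial of the primitive element kills `T`
  have hP : aeval T (minpoly ℚ pb.gen) = 0 := by
    have : T = (Module.End.baseChangeHom ℚ ℂ V).comp A.ι pb.gen := rfl
    rw [this, aeval_algHom_apply, minpoly.aeval, map_zero]
  -- over `ℂ` it is the product of the `X - a` over its (simple) roots `a`
  set P : ℂ[X] := (minpoly ℚ pb.gen).map (algebraMap ℚ ℂ) with hPdef
  have hPmonic : P.Monic := (minpoly.monic (Algebra.IsIntegral.isIntegral pb.gen)).map _
  have hnodup : P.roots.Nodup :=
    nodup_roots (Polynomial.Separable.map (Algebra.IsSeparable.isSeparable ℚ pb.gen))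
  have hPprod : P = ∏ a ∈ P.roots.toFinset, (X - C a) := by
    conv_lhs => rw [(IsAlgClosed.splits P).eq_prod_roots_of_monic hPmonic]
    rw [Finset.prod_eq_multiset_prod, Multiset.toFinset_val, hnodup.dedup]
  have hx0 : aeval T (∏ a ∈ P.roots.toFinset, (X - C a)) x = 0 := by
    rw [← hPprod, hPdef, aeval_map_algebraMap, hP, LinearMap.zero_apply]
  -- kernel decomposition on the `T`-stable piece `W`
  have hmem := mem_iSup_inf_eigenspace_of_aeval_prod_eq_zero hWT P.roots.toFinset x hx hx0
  refine (iSup₂_le fun a ha => ?_ : ⨆ a ∈ P.roots.toFinset, W ⊓ T.eigenspace a ≤ _) hmem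
  -- every root is `σ α` for an embedding `σ`, and `W ∩ ker (T - σ α) ≤ V^{p,q}_σ`
  have ha' : a ∈ (minpoly ℚ pb.gen).rootSet ℂ := by
    rw [rootSet_def, Finset.mem_coe]
    exact ha
  rw [← NumberField.Embeddings.range_eval_eq_rootSet_minpoly] at ha'
  obtain ⟨σ, rfl⟩ := ha'
  refine le_trans ?_ (le_iSup _ σ)
  rintro y ⟨hyW, hyT⟩
  rw [mem_eigenPiece_iff]
  exact ⟨hyW, A.baseChange_apply_of_mem_eigenspace_gen pb σ hyT⟩

end HodgeStructure.EndAction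

namespace HodgeStructure

/-! ### Discharge of `multiplicity_add_multiplicity_conjugate` and
`mem_cmType_iff_conjugate_notMem` (Deligne, LNM 900, Example 3.7 and §5) -/

/-- For an **effective** Hodge structure the filtration starts at the top: `F^m = V_ℂ` for
`m ≤ 0`. (If `l` is least with `F^l ≠ V_ℂ`, then `V^{n+1-l, l-1} = F^{n+1-l}` vanishes by
effectivity, so `conj F^l = V_ℂ` by opposedness.) (Deligne, *Théorie de Hodge II*, 1.2.5,
2.2.) [folklore] -/
theorem IsEffective.F_eq_top {H : HodgeStructure V n} (hH : H.IsEffective) {m : ℤ}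
    (hm : m ≤ 0) : H.F m = ⊤ := by
  by_contra hne
  obtain ⟨a, ha⟩ := H.exists_F_eq_top
  obtain ⟨l, hl, hmin⟩ := Int.exists_least_of_bdd (P := fun z => H.F z ≠ ⊤)
    ⟨a, fun z hz => le_of_lt (lt_of_not_ge fun hza => hz
      (eq_top_iff.2 (ha ▸ H.antitone_F hza)))⟩ ⟨m, hne⟩
  have hl1 : H.F (l - 1) = ⊤ := by
    by_contra h
    have := hmin (l - 1) h
    omega
  have hpiece : H.piece (n + 1 - l) (l - 1) = H.F (n + 1 - l) := by
    rw [piece_of_add_eq H (by ring), hl1, complexConj_top, inf_top_eq]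
  have hbot : H.F (n + 1 - l) = ⊥ := by
    by_contra h
    have h' : H.piece (n + 1 - l) (l - 1) ≠ ⊥ := by rwa [hpiece]
    have h0 := (hH _ _ h').2
    have := hmin m hne
    omega
  have hc := H.isCompl_F_complexConj (n + 1 - l) l (by ring)
  rw [hbot] at hc
  have htop : complexConj (H.F l) = ⊤ := bot_codisjoint.1 hc.codisjoint
  exact hl (by rw [← complexConj_complexConj (H.F l), htop, complexConj_top])

/-- In an effective Hodge structure of weight `1`, `V^{1,0} = F^1` (since `F^0 = V_ℂ`).
[folklore] -/
theorem piece_one_zero_eq_F {H : HodgeStructure V 1} (hH : H.IsEffective) :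
    H.piece 1 0 = H.F 1 := by
  rw [piece_of_add_eq H (by norm_num), hH.F_eq_top le_rfl, complexConj_top, inf_top_eq]

/-- `conj` restricts to an antilinear bijection `conj W ≃ W`, so `dim_ℂ conj W = dim_ℂ W`
(Voisin, *Hodge Theory I*, §7.1.1). [folklore] -/
theorem finrank_complexConj (W : Submodule ℂ (ℂ ⊗[ℚ] V)) :
    Module.finrank ℂ (complexConj W) = Module.finrank ℂ W := by
  let j : complexConj W ≃+ W :=
    { toFun := fun x => ⟨conj x.1, x.2⟩
      invFun := fun y => ⟨conj y.1, show conj (conj y.1) ∈ W by rw [conj_conj]; exact y.2⟩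
      left_inv := fun x => by ext; simp
      right_inv := fun y => by ext; simp
      map_add' := fun x y => by ext; simp [map_add] }
  unfold Module.finrank
  rw [rank_eq_of_equiv_equiv (starRingEnd ℂ) j
    (Function.Involutive.bijective fun c => starRingEnd_self_apply c)
    (fun c x => Subtype.ext (conj_smul c x.1))]

namespace EndAction

variable {E : Type*} [Field E] [NumberField E]

section General

variable {H : HodgeStructure V n}

/-- Membership in the simultaneous eigenspace `V_{ℂ,σ}`. [folklore] -/
theorem mem_iInf_eigenspace_iff (A : EndAction H E) (σ : E →+* ℂ) (x : ℂ ⊗[ℚ] V) :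
    x ∈ (⨅ e, Module.End.eigenspace ((A.ι e).baseChange ℂ) (σ e)) ↔
      ∀ e : E, (A.ι e).baseChange ℂ x = σ e • x := by
  simp [Submodule.mem_iInf]

/-- Complex conjugation exchanges `V_{ℂ,σ}` and `V_{ℂ,σ̄}` (the action is defined over `ℚ`)
(Deligne, LNM 900, §4); as in `complexConj_eigenPiece_holds`, from
`complexConj_eigenspace_baseChange`. [folklore] -/
theorem complexConj_iInf_eigenspace (A : EndAction H E) (σ : E →+* ℂ) :
    complexConj (⨅ e, Module.End.eigenspace ((A.ι e).baseChange ℂ) (σ e)) =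
      ⨅ e, Module.End.eigenspace ((A.ι e).baseChange ℂ)
        (NumberField.ComplexEmbedding.conjugate σ e) := by
  rw [← complexConjOrderIso_apply (⨅ e : E, _), OrderIso.map_iInf]
  refine iInf_congr fun e => ?_
  rw [complexConjOrderIso_apply, complexConj_eigenspace_baseChange,
    NumberField.ComplexEmbedding.conjugate_coe_eq]

/-- The action preserves each `F^p`. [folklore] -/
theorem baseChange_mem_F (A : EndAction H E) (e : E) {p : ℤ} {x : ℂ ⊗[ℚ] V} (hx : x ∈ H.F p) :
    (A.ι e).baseChange ℂ x ∈ H.F p :=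
  A.map_F_le e p ⟨_, hx, rfl⟩

/-- The action preserves each `conj F^p` (it commutes with `conj`). [folklore] -/
theorem baseChange_mem_complexConj_F (A : EndAction H E) (e : E) {p : ℤ} {x : ℂ ⊗[ℚ] V}
    (hx : x ∈ complexConj (H.F p)) : (A.ι e).baseChange ℂ x ∈ complexConj (H.F p) := by
  rw [mem_complexConj] at hx ⊢
  rw [conj_baseChange]
  exact A.baseChange_mem_F e hx

/-- If `V_ℂ = P ⊕ Q` with `P`, `Q` stable under the action, then
`V_{ℂ,σ} = (V_{ℂ,σ} ∩ P) ⊕ (V_{ℂ,σ} ∩ Q)`: the components of a simultaneous eigenvector are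
simultaneous eigenvectors. [folklore] -/
theorem iInf_eigenspace_eq_inf_sup_inf (A : EndAction H E) (σ : E →+* ℂ)
    {P Q : Submodule ℂ (ℂ ⊗[ℚ] V)} (hPQ : IsCompl P Q)
    (hP : ∀ e, ∀ x ∈ P, (A.ι e).baseChange ℂ x ∈ P)
    (hQ : ∀ e, ∀ x ∈ Q, (A.ι e).baseChange ℂ x ∈ Q) :
    (⨅ e, Module.End.eigenspace ((A.ι e).baseChange ℂ) (σ e)) =
      (⨅ e, Module.End.eigenspace ((A.ι e).baseChange ℂ) (σ e)) ⊓ P ⊔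
        (⨅ e, Module.End.eigenspace ((A.ι e).baseChange ℂ) (σ e)) ⊓ Q := by
  refine le_antisymm (fun x hx => ?_) (sup_le inf_le_left inf_le_left)
  have hx' : x ∈ P ⊔ Q := hPQ.sup_eq_top ▸ Submodule.mem_top
  obtain ⟨y, hy, z, hz, rfl⟩ := Submodule.mem_sup.1 hx'
  have hyz := (A.mem_iInf_eigenspace_iff σ _).1 hx
  have hy' : y ∈ (⨅ e, Module.End.eigenspace ((A.ι e).baseChange ℂ) (σ e)) := by
    rw [mem_iInf_eigenspace_iff]
    intro e
    have h1 : (A.ι e).baseChange ℂ y - σ e • y ∈ P := P.sub_mem (hP e y hy) (P.smul_mem _ hy)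
    have h2 : (A.ι e).baseChange ℂ z - σ e • z ∈ Q := Q.sub_mem (hQ e z hz) (Q.smul_mem _ hz)
    have h12 : (A.ι e).baseChange ℂ y - σ e • y = -((A.ι e).baseChange ℂ z - σ e • z) := by
      rw [eq_neg_iff_add_eq_zero, sub_add_sub_comm, ← map_add, ← smul_add, hyz e, sub_self]
    have hmem : (A.ι e).baseChange ℂ y - σ e • y ∈ P ⊓ Q := ⟨h1, h12 ▸ Q.neg_mem h2⟩
    rw [hPQ.inf_eq_bot, Submodule.mem_bot] at hmem
    exact sub_eq_zero.1 hmem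
  have hz' : z ∈ (⨅ e, Module.End.eigenspace ((A.ι e).baseChange ℂ) (σ e)) := by
    have := Submodule.sub_mem _ hx hy'
    rwa [add_sub_cancel_left] at this
  exact Submodule.add_mem _ (Submodule.mem_sup_left ⟨hy', hy⟩)
    (Submodule.mem_sup_right ⟨hz', hz⟩)

/-- The `E`-module structure `Module.compHom V ι` on `V` (`A.module` in weight `1`) is
compatible with the `ℚ`-structure. [folklore] -/
theorem isScalarTower_compHom (A : EndAction H E) :
    letI := Module.compHom V (A.ι : E →+* Module.End ℚ V); IsScalarTower ℚ E V := by
  letI := Module.compHom V (A.ι : E →+* Module.End ℚ V)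
  refine ⟨fun q e v => ?_⟩
  show A.ι (q • e) v = q • A.ι e v
  rw [map_smul, LinearMap.smul_apply]

/-- **Structure of `V_ℂ` as an `E ⊗ ℂ`-module** (Deligne, LNM 900, Example 3.7:
`H₁(A) ⊗ ℂ ≃ E ⊗_ℚ ℂ ≃ ℂ^S`, `S = Hom(E, ℂ)`; §4, p. 30: `H¹ ⊗ ℂ = ⊕_σ H¹_σ`): for `V`
finite-dimensional, each simultaneous eigenspace `V_{ℂ,σ}` has `dim_ℂ V_{ℂ,σ} = dim_E V`, i.e.
`dim_ℂ V_{ℂ,σ} · [E:ℚ] = dim_ℚ V`. Proof: an `E`-basis of `V` gives `V ≃ E^r`, and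
`E ⊗_ℚ ℂ ≃ ℂ^S` by `NumberField.canonicalEmbedding.latticeBasis` (nonvanishing of the
discriminant), under which `E` acts on the `σ`-th coordinate through `σ`. [folklore] -/
theorem finrank_iInf_eigenspace_mul_finrank [FiniteDimensional ℚ V] (A : EndAction H E)
    (σ : E →+* ℂ) :
    Module.finrank ℂ ↥(⨅ e, Module.End.eigenspace ((A.ι e).baseChange ℂ) (σ e)) *
      Module.finrank ℚ E = Module.finrank ℚ V := by
  classical
  letI := Module.compHom V (A.ι : E →+* Module.End ℚ V)
  haveI := A.isScalarTower_compHom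
  haveI : Module.Finite E V := Module.Finite.of_restrictScalars_finite ℚ E V
  -- an `E`-basis of `V` and the coordinate isomorphism `V ≃ E^r`, `ℚ`-linearly
  set r := Module.finrank E V with hr
  let b := Module.finBasis E V
  let φ : V →ₗ[ℚ] (Fin r → E) := (b.equivFun.restrictScalars ℚ).toLinearMap
  have hφ : ∀ (e : E) (v : V), φ (A.ι e v) = e • φ v := fun e v => by
    show b.equivFun (e • v) = e • b.equivFun v
    rw [map_smul]
  -- `θ₀ v i τ = τ (i-th coordinate of v)`
  let S := E →+* ℂ
  let ψ : E →ₗ[ℚ] (S → ℂ) := (NumberField.canonicalEmbedding E).toRatAlgHom.toLinearMap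
  let θ₀ : V →ₗ[ℚ] (Fin r → S → ℂ) := ψ.compLeft (Fin r) ∘ₗ φ
  have hθ₀ : ∀ v i, θ₀ v i = NumberField.canonicalEmbedding E (φ v i) := fun v i => rfl
  let Θ₀ : ℂ ⊗[ℚ] V →ₗ[ℂ] (Fin r → S → ℂ) := θ₀.liftBaseChange ℂ
  -- the diagonal action of `e`
  let D : E → (Fin r → S → ℂ) := fun e _ => NumberField.canonicalEmbedding E e
  have hΘι : ∀ (e : E) (x : ℂ ⊗[ℚ] V), Θ₀ ((A.ι e).baseChange ℂ x) = D e * Θ₀ x := by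
    intro e x
    induction x using TensorProduct.induction_on with
    | zero => simp
    | tmul c v =>
      rw [LinearMap.baseChange_tmul]
      simp only [Θ₀, LinearMap.liftBaseChange_tmul]
      rw [mul_smul_comm]
      congr 1
      ext i τ
      rw [hθ₀, hφ, Pi.mul_apply, Pi.mul_apply, hθ₀, Pi.smul_apply, smul_eq_mul, map_mul]
      rfl
    | add x y hx hy => simp only [map_add, hx, hy, mul_add]
  -- `Θ₀` is surjective: its range contains the basis `Pi.single i (latticeBasis j)`
  have hΘsurj : Function.Surjective Θ₀ := by
    rw [← LinearMap.range_eq_top, eq_top_iff,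
      ← (Pi.basis fun _ : Fin r => NumberField.canonicalEmbedding.latticeBasis E).span_eq,
      Submodule.span_le]
    rintro _ ⟨⟨i, j⟩, rfl⟩
    refine ⟨(1 : ℂ) ⊗ₜ b.equivFun.symm (Pi.single i (NumberField.integralBasis E j)), ?_⟩
    rw [Pi.basis_apply]
    simp only [Θ₀, LinearMap.liftBaseChange_tmul, one_smul]
    ext k τ
    rw [hθ₀]
    simp only [φ, LinearEquiv.coe_coe, LinearEquiv.restrictScalars_apply,
      LinearEquiv.apply_symm_apply, NumberField.canonicalEmbedding.latticeBasis_apply]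
    rw [Pi.apply_single (fun _ => NumberField.canonicalEmbedding E) (fun _ => map_zero _) i]
  -- dimensions
  have hcard : Fintype.card S = Module.finrank ℚ E := NumberField.Embeddings.card E ℂ
  have hV : Module.finrank ℚ V = Module.finrank ℚ E * r := (Module.finrank_mul_finrank ℚ E V).symm
  have hfin : Module.finrank ℂ (ℂ ⊗[ℚ] V) = Module.finrank ℂ (Fin r → S → ℂ) := by
    rw [Module.finrank_baseChange, Module.finrank_pi_fintype ℂ, hV]
    simp only [Module.finrank_pi ℂ, Finset.sum_const, Finset.card_univ, Fintype.card_fin,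
      smul_eq_mul, hcard, mul_comm]
  have hΘinj : Function.Injective Θ₀ :=
    (LinearMap.injective_iff_surjective_of_finrank_eq_finrank hfin).2 hΘsurj
  let Θ : ℂ ⊗[ℚ] V ≃ₗ[ℂ] (Fin r → S → ℂ) := LinearEquiv.ofBijective Θ₀ ⟨hΘinj, hΘsurj⟩
  -- the `σ`-th coordinate lines
  let slot : (Fin r → ℂ) →ₗ[ℂ] (Fin r → S → ℂ) :=
    (LinearMap.single ℂ (fun _ : S => ℂ) σ).compLeft (Fin r)
  have hslot : ∀ (h : Fin r → ℂ) (i : Fin r) (τ : S),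
      slot h i τ = (Pi.single σ (h i) : S → ℂ) τ := fun h i τ => rfl
  have hslot_inj : Function.Injective slot := by
    intro h h' hh
    ext i
    have := congrFun (congrFun hh i) σ
    simpa [hslot] using this
  have hne : ∀ τ : S, τ ≠ σ → ∃ e, τ e ≠ σ e := fun τ hτ => by
    by_contra! h
    exact hτ (RingHom.ext h)
  have hmem : ∀ x, x ∈ (⨅ e, Module.End.eigenspace ((A.ι e).baseChange ℂ) (σ e)) ↔
      Θ₀ x ∈ LinearMap.range slot := by
    intro x
    rw [mem_iInf_eigenspace_iff, LinearMap.mem_range]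
    constructor
    · intro hx
      refine ⟨fun i => Θ₀ x i σ, ?_⟩
      ext i τ
      rw [hslot]
      by_cases hτ : τ = σ
      · subst hτ; rw [Pi.single_eq_same]
      · rw [Pi.single_eq_of_ne hτ]
        obtain ⟨e, he⟩ := hne τ hτ
        have h := congrFun (congrFun (hΘι e x) i) τ
        rw [hx e, map_smul, Pi.smul_apply, Pi.smul_apply, smul_eq_mul, Pi.mul_apply,
          Pi.mul_apply] at h
        have h' : (σ e - τ e) * Θ₀ x i τ = 0 := by
          rw [sub_mul, sub_eq_zero]; exact h
        rcases mul_eq_zero.1 h' with h'' | h''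
        · exact absurd (sub_eq_zero.1 h'').symm he
        · exact h''.symm
    · rintro ⟨h, hh⟩ e
      apply hΘinj
      rw [hΘι, map_smul, ← hh]
      ext i τ
      rw [Pi.mul_apply, Pi.mul_apply, Pi.smul_apply, Pi.smul_apply, smul_eq_mul, hslot]
      by_cases hτ : τ = σ
      · subst hτ; rfl
      · rw [Pi.single_eq_of_ne hτ, mul_zero, mul_zero]
  have heq : (⨅ e, Module.End.eigenspace ((A.ι e).baseChange ℂ) (σ e)) =
      (LinearMap.range slot).comap (Θ : ℂ ⊗[ℚ] V →ₗ[ℂ] (Fin r → S → ℂ)) := by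
    ext x; exact hmem x
  have hfr : Module.finrank ℂ ↥((⨅ e, Module.End.eigenspace ((A.ι e).baseChange ℂ) (σ e))) = r := by
    rw [heq, Submodule.comap_equiv_eq_map_symm, LinearEquiv.finrank_map_eq,
      LinearMap.finrank_range_of_inj hslot_inj, Module.finrank_pi ℂ, Fintype.card_fin]
  rw [hfr, hV, mul_comm]

end General

section WeightOne

variable {H : HodgeStructure V 1}

/-- **Discharge of `multiplicity_add_multiplicity_conjugate`**: `(n_σ + n_σ̄) · [E:ℚ] = dim_ℚ V`
for an effective weight-`1` Hodge structure with `E`-action, `V` finite-dimensional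
(Deligne, LNM 900, §4 and Example 3.7; Moonen–Zarhin 1995, 2.2). Proof:
`V_ℂ = F^1 ⊕ conj F^1` with both summands `E`-stable gives
`V_{ℂ,σ} = V^{1,0}_σ ⊕ (V_{ℂ,σ} ∩ conj F^1)`, `conj` maps the second summand antilinearly onto
`V^{1,0}_{σ̄}`, and `dim_ℂ V_{ℂ,σ} · [E:ℚ] = dim_ℚ V`
(`finrank_iInf_eigenspace_mul_finrank`). [cite: DeligneLNM900, Example 3.7] -/
theorem multiplicity_add_multiplicity_conjugate_holds :
    multiplicity_add_multiplicity_conjugate (H := H) (E := E) := by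
  intro _ hH A σ
  -- `T τ = V_{ℂ,τ}`, the full simultaneous `τ`-eigenspace
  set T : (E →+* ℂ) → Submodule ℂ (ℂ ⊗[ℚ] V) :=
    fun τ => ⨅ e, Module.End.eigenspace ((A.ι e).baseChange ℂ) (τ e) with hT
  have hc : IsCompl (H.F 1) (complexConj (H.F 1)) := H.isCompl_F_complexConj 1 1 (by norm_num)
  have hdec : T σ = T σ ⊓ H.F 1 ⊔ T σ ⊓ complexConj (H.F 1) :=
    A.iInf_eigenspace_eq_inf_sup_inf σ hc (fun e x hx => A.baseChange_mem_F e hx)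
      (fun e x hx => A.baseChange_mem_complexConj_F e hx)
  have key := Submodule.finrank_sup_add_finrank_inf_eq (T σ ⊓ H.F 1) (T σ ⊓ complexConj (H.F 1))
  have hinf : (T σ ⊓ H.F 1) ⊓ (T σ ⊓ complexConj (H.F 1)) = ⊥ :=
    eq_bot_iff.2 ((inf_le_inf inf_le_right inf_le_right).trans hc.inf_eq_bot.le)
  rw [← hdec, hinf, finrank_bot, add_zero] at key
  have hm : ∀ τ : E →+* ℂ, A.multiplicity τ = Module.finrank ℂ ↥(T τ ⊓ H.F 1) := by
    intro τ
    rw [multiplicity, eigenPiece, piece_one_zero_eq_F hH, inf_comm]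
  have hconj : Module.finrank ℂ ↥(T (NumberField.ComplexEmbedding.conjugate σ) ⊓ H.F 1) =
      Module.finrank ℂ ↥(T σ ⊓ complexConj (H.F 1)) := by
    rw [← finrank_complexConj (T σ ⊓ complexConj (H.F 1)), complexConj_inf, hT,
      complexConj_iInf_eigenspace, complexConj_complexConj]
  rw [hm, hm, hconj, ← key, A.finrank_iInf_eigenspace_mul_finrank σ]

/-- For a CM action, `n_σ + n_σ̄ = 1` for every `σ : E → ℂ` (Deligne, LNM 900, Example 3.7:
`H₁ ⊗ ℂ ≃ ℂ^S = ℂ^Σ ⊕ ℂ^{ιΣ}`, `ℂ^Σ` of type `(-1,0)` and `ℂ^{ιΣ}` of type `(0,-1)`).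
[cite: DeligneLNM900, Example 3.7] -/
theorem IsCM.multiplicity_add_multiplicity_conjugate_eq_one {A : EndAction H E} (hA : A.IsCM)
    (σ : E →+* ℂ) :
    A.multiplicity σ + A.multiplicity (NumberField.ComplexEmbedding.conjugate σ) = 1 := by
  obtain ⟨hH, -, h1⟩ := hA
  letI := A.module
  haveI : IsScalarTower ℚ E V := A.isScalarTower_compHom
  haveI : Module.Finite E V := Module.finite_of_finrank_pos (by rw [h1]; exact one_pos)
  haveI : FiniteDimensional ℚ V := Module.Finite.trans E V
  have hV : Module.finrank ℚ V = Module.finrank ℚ E := by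
    rw [← Module.finrank_mul_finrank ℚ E V, h1, mul_one]
  have h := multiplicity_add_multiplicity_conjugate_holds hH A σ
  rw [hV] at h
  exact (mul_eq_right₀ (Module.finrank_pos (R := ℚ) (M := E)).ne').1 h

/-- **Discharge of `mem_cmType_iff_conjugate_notMem`**: for a CM action, `Φ = cmType A` is a
CM type, `σ ∈ Φ ↔ σ̄ ∉ Φ`, since `n_σ + n_σ̄ = 1` with `n_σ, n_σ̄ ∈ ℕ` (Deligne, LNM 900,
Example 3.7, and §5, p. 37: the abelian varieties with complex multiplication by `E` are
indexed by the `Φ ⊂ S = Hom(E, ℂ)` with `S = Φ ⊔ ιΦ`).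
[cite: DeligneLNM900, Example 3.7 and §5 p. 37] -/
theorem mem_cmType_iff_conjugate_notMem_holds :
    mem_cmType_iff_conjugate_notMem (H := H) (E := E) := by
  intro A hA σ
  have h := hA.multiplicity_add_multiplicity_conjugate_eq_one σ
  rw [mem_cmType_iff, mem_cmType_iff]
  omega

/-- The CM type of a CM action as a `CMType E` (Deligne, LNM 900, §5): the anonymous
constructor applied to `cmType A` and the discharge above. [folklore] -/
theorem IsCM.exists_cmType_eq {A : EndAction H E} (hA : A.IsCM) :
    ∃ Φ : CMType E, Φ.1 = A.cmType :=
  ⟨⟨A.cmType, fun φ => mem_cmType_iff_conjugate_notMem_holds A hA φ⟩, rfl⟩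

end WeightOne

end EndAction

end HodgeStructure

end Literature.AlgebraicGeometry.Motives

end
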